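/-
Origin: expansion seat `prover-pub-hodgecm-mc-binder-1-g14-0`, handover #R88 2026-08-20T16:54:41Z md5 d2b1735d2c55 (172 l.; NEW additive leaf (universe-free), (J5) reflex field of the L-type S* = corner field, type half; imports #R87 ONLY; drop-alone; NAME LIST: HodgeCM.SignRecipe.reflexField_liftTypeSet_eq_fieldRange · HodgeCM.SignRecipe.image_reflexLift_liftTypeSet_eq_pullbackTypeAlg · HodgeCM.SignRecipe.stabilizer_image_coe_eq) (`HOME/mc/pub-hodgecm-mc-binder-1-g14/stage56/HodgeCM/Model/Binders/JLiuReflexField.lean`, md5 d2b1735d2c55, 172 lines);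
landed by the second packager p2 gen 10 (p2-g10) in gate run 56 as `HodgeCM/Model/Binders/JLiuReflexField.lean` (packager comment re-wording per the RUN-32 precedent (gate audit (5) rejects the proof-placeholder tokens s-o-r-r-y / a-d-m-i-t anywhere in a source, comments included): 1 occurrence(s) inside COMMENTS re-spelt `proof-hole` / `adm-token`; no Lean code byte touched).
-/
/-
Copyright (c) 2026 the pub-hodgecm formalisation cell (harness21).  New file, not vendored.
Origin: session prover-pub-hodgecm-mc-binder-1-g14-0 (unit pub-hodgecm-mc-binder-1-g14, BINDER PROVER gen 14 of lineage mc-binder-1;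
content lane (J-Liu-Θ) of BINDER-TRIAGE §58.2, scope memo `HOME/mc/pub-hodgecm-mc-binder-1-g14/JLIU-THETA-SCOPE.md` item (J5)),
2026-08-20.  Intended final place: `HodgeCM/Model/Binders/JLiuReflexField.lean` (NEW additive leaf; imports `HodgeCM.Model.Binders.JLiuReflexLift`
(this kit); nothing imports it; install after it; drop alone on bounce).
-/
import Summits.HodgeConjecture.HodgeCM.Model.Binders.JLiuReflexLift

set_option autoImplicit false

/-!
# The reflex FIELD of the recipe's type is the corner field — PerL Lemma [lem:reflex] (b), field half — item (J5)

KERNEL over `Model/Binders/JLiuReflexLift` and the vendored `Literature.NumberTheory.ComplexMultiplication.{EmbeddingAction, ReflexType}`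
([Shimura1998 §8.1 Prop. 25, §8.3 Prop. 28], [Streng2010 Ch. I Lemma 7.2]: `typeLift`, `reflexLift = S*`, `IsPrimitive`, `reflexField`,
`IsPrimitive.fixedField_stabilizer_reflexLift_eq`).  No new hypothesis kind, nothing cited anew, nothing minted.

The `ℚ`-algebra version of `JLiuReflexLift` (the tree's reflex theory lives on `K →ₐ[ℚ] L`, `L ≃ₐ[ℚ] L`):

* `pullbackTypeAlg ι₁ Ψ : Set (K →ₐ[ℚ] L)` — the corner type read inside `L` through `ι₁`; `mem_liftType_false_iff_mem_reflexLift_alg`: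
  `ι₁ ∘ g ∈ Φ_Ψ^{(false)} ↔ g ∈ S*(Ψ_L, j)` for `g : L ≃ₐ[ℚ] L` (same statement as (R1), `ℚ`-algebra carriers);
* `stabilizer_image_coe_eq` — bookkeeping: the stabiliser of `S* ⊆ Aut(L)` READ AS A TYPE OF `L` (a set of embeddings `L →ₐ[ℚ] L`, action by
  composition) is its left stabiliser in `Aut(L)`;
* **`reflexField_liftTypeSet_eq_fieldRange`** — for `L/ℚ` Galois and a PRIMITIVE corner type: the reflex field ([Shimura1998 §8.3]: fixed field
  of `{γ ∣ γ S* = S*}`) of the `L`-type `S*(Ψ_L, j)` is `j(K)`: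
  `reflexField ℚ L (↑ '' S*(Ψ_L, j)) = (j : K →ₐ[ℚ] L).fieldRange`.
  With (R1) this says: the reflex field of `(L, Φ_{Ψ_i})` — Liu's `M'_μ` (Def. 4.3) once (J4a) identifies `Φ_μ = Φ_{Ψ_i}` — is the corner field
  `K` embedded by `j`, which is the `k₂ : K ↪ M_μ ⊇ M'_μ` that `CommonReflexInput.ofInflated` (`Model/CommonReflexOfInflated`) consumes.  The TYPE
  half (`reflexType … = Ψ`) is the tree's `ReflexPair.image_typeLift_reflexType_reflexType` (to be vendored).

0 `proof-hole`, 0 `axiom`; expected `#print axioms` ⊆ {propext, Classical.choice, Quot.sound}.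
-/

noncomputable section

open scoped Pointwise
open NumberField NumberField.ComplexEmbedding
open Literature.AlgebraicGeometry.Motives (CMType)
open Literature.NumberTheory.ComplexMultiplication

namespace HodgeCM

namespace SignRecipe

variable {K L : CMField} (j : K →+* L) (ι₁ : L →+* ℂ)

/-- **The corner type read inside `L`, `ℚ`-algebra carriers**: `Ψ_L := {ψ : K →ₐ[ℚ] L ∣ ι₁ ∘ ψ ∈ Ψ}`. [folklore] -/
def pullbackTypeAlg (Ψ : CMType K) : Set (K →ₐ[ℚ] L) := {ψ | ι₁.comp ψ.toRingHom ∈ Ψ.1}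

variable {j ι₁}

/-- (Ported verbatim from the HodgeCMPerL package; no docstring in the source.) -/
@[simp] theorem mem_pullbackTypeAlg_iff (Ψ : CMType K) (ψ : K →ₐ[ℚ] L) :
    ψ ∈ pullbackTypeAlg ι₁ Ψ ↔ ι₁.comp ψ.toRingHom ∈ Ψ.1 := Iff.rfl

/-- `g ∈ S*(Ψ_L, j) ↔ ι₁ ∘ g⁻¹ ∘ j ∈ Ψ` for `g : L ≃ₐ[ℚ] L`. [folklore] -/
theorem mem_reflexLift_pullbackTypeAlg_iff (Ψ : CMType K) (g : L ≃ₐ[ℚ] L) :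
    g ∈ (reflexLift (pullbackTypeAlg ι₁ Ψ) j.toRatAlgHom : Set (L ≃ₐ[ℚ] L)) ↔
      (ι₁.comp g.symm.toRingEquiv.toRingHom).comp j ∈ Ψ.1 := by
  rw [mem_reflexLift, mem_pullbackTypeAlg_iff]
  have : ι₁.comp (g⁻¹ • j.toRatAlgHom).toRingHom = (ι₁.comp g.symm.toRingEquiv.toRingHom).comp j :=
    RingHom.ext fun x => rfl
  rw [this]

/-- **`Φ_Ψ^{(false)}` is `S*`, `ℚ`-algebra carriers**: `ι₁ ∘ g ∈ Φ_Ψ ↔ g ∈ reflexLift Ψ_L j` for `g : L ≃ₐ[ℚ] L`. [folklore] -/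
theorem mem_liftType_false_iff_mem_reflexLift_alg (Ψ : CMType K) (g : L ≃ₐ[ℚ] L) :
    ι₁.comp g.toRingEquiv.toRingHom ∈ (liftType false K L j ι₁ Ψ).1 ↔
      g ∈ (reflexLift (pullbackTypeAlg ι₁ Ψ) j.toRatAlgHom : Set (L ≃ₐ[ℚ] L)) := by
  rw [mem_liftType_false_iff_mem_reflexLift Ψ g.toRingEquiv, mem_reflexLift_pullbackType_iff,
    mem_reflexLift_pullbackTypeAlg_iff]
  rfl

/-- The other bit, `ℚ`-algebra carriers: `ι₁ ∘ g ∈ Φ_Ψ^{(true)} ↔ g ∉ reflexLift Ψ_L j`. [folklore] -/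
theorem mem_liftType_true_iff_not_mem_reflexLift_alg (Ψ : CMType K) (g : L ≃ₐ[ℚ] L) :
    ι₁.comp g.toRingEquiv.toRingHom ∈ (liftType true K L j ι₁ Ψ).1 ↔
      g ∉ (reflexLift (pullbackTypeAlg ι₁ Ψ) j.toRatAlgHom : Set (L ≃ₐ[ℚ] L)) := by
  rw [mem_liftType_true_iff_not_mem_liftType_false Ψ g.toRingEquiv, mem_liftType_false_iff_mem_reflexLift_alg]

/-! ## The reflex field of the `L`-type `S*` -/

section ReflexField

variable {L : Type*} [Field L] [Algebra ℚ L]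

/-- An `L`-automorphism acting on an embedding `L →ₐ[ℚ] L` that is itself an automorphism: `g • ↑σ = ↑(g * σ)`. [folklore] -/
theorem smul_coe_algEquiv (g σ : L ≃ₐ[ℚ] L) : g • (σ : L →ₐ[ℚ] L) = ((g * σ : L ≃ₐ[ℚ] L) : L →ₐ[ℚ] L) :=
  AlgHom.ext fun _ => rfl

/-- `g • (↑ '' S) = ↑ '' (g • S)` for `S ⊆ Aut(L)` (left translation). [folklore] -/
theorem smul_image_coe_eq (g : L ≃ₐ[ℚ] L) (S : Set (L ≃ₐ[ℚ] L)) :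
    g • ((fun σ : L ≃ₐ[ℚ] L => (σ : L →ₐ[ℚ] L)) '' S) = (fun σ : L ≃ₐ[ℚ] L => (σ : L →ₐ[ℚ] L)) '' (g • S) := by
  ext ψ
  simp only [Set.mem_smul_set, Set.mem_image]
  constructor
  · rintro ⟨_, ⟨σ, hσ, rfl⟩, rfl⟩
    exact ⟨g * σ, ⟨σ, hσ, rfl⟩, (smul_coe_algEquiv g σ).symm⟩
  · rintro ⟨_, ⟨σ, hσ, rfl⟩, rfl⟩
    exact ⟨σ, ⟨σ, hσ, rfl⟩, smul_coe_algEquiv g σ⟩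

/-- **Bookkeeping**: the stabiliser of `S* ⊆ Aut(L)` read as a TYPE OF `L` (embeddings `L →ₐ[ℚ] L`, action by composition) is its left
stabiliser in `Aut(L)`. [folklore] -/
theorem stabilizer_image_coe_eq (S : Set (L ≃ₐ[ℚ] L)) :
    MulAction.stabilizer (L ≃ₐ[ℚ] L) ((fun σ : L ≃ₐ[ℚ] L => (σ : L →ₐ[ℚ] L)) '' S) = MulAction.stabilizer (L ≃ₐ[ℚ] L) S := by
  have hinj : Function.Injective (fun σ : L ≃ₐ[ℚ] L => (σ : L →ₐ[ℚ] L)) :=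
    fun σ τ hστ => AlgEquiv.ext (fun x => AlgHom.congr_fun hστ x)
  ext g
  simp only [MulAction.mem_stabilizer_iff, smul_image_coe_eq]
  exact (Set.image_injective.mpr hinj).eq_iff

/-- **The reflex field of the `L`-type `S*(Φ, φ)` is `φ(K)`** for `L/ℚ` Galois and `(Φ, φ)` PRIMITIVE — [Streng2010 Ch. I Lemma 7.2]
«`Kʳʳ = K`» read on the lift: `S*` as a type of `L` is the inflation of the reflex type, whose reflex field is `Kʳʳ`. [folklore] -/
theorem reflexField_image_reflexLift_eq_fieldRange [IsGalois ℚ L] {K : Type*} [Field K] [Algebra ℚ K]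
    {Φ : Set (K →ₐ[ℚ] L)} {φ : K →ₐ[ℚ] L} (hP : IsPrimitive (L ≃ₐ[ℚ] L) Φ φ) :
    reflexField ℚ L ((fun σ : L ≃ₐ[ℚ] L => (σ : L →ₐ[ℚ] L)) '' (reflexLift Φ φ : Set (L ≃ₐ[ℚ] L))) = φ.fieldRange := by
  rw [reflexField_eq_fixedField, stabilizer_image_coe_eq, hP.fixedField_stabilizer_reflexLift_eq]

/-- **The lifted reflex type of the `L`-type `S*` is `S`**: with base point the identity of `L`, `reflexLift (↑ '' S*(Φ, φ)) id = S(Φ, φ)`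
(`g⁻¹ ∘ id ∈ S* ↔ g ∈ S`, [Shimura1998 §8.3] «`S*(Φ*, ι*) = S`» read on the lift). [folklore] -/
theorem reflexLift_image_reflexLift_id_eq_typeLift {K : Type*} [Field K] [Algebra ℚ K] (Φ : Set (K →ₐ[ℚ] L)) (φ : K →ₐ[ℚ] L) :
    (reflexLift ((fun σ : L ≃ₐ[ℚ] L => (σ : L →ₐ[ℚ] L)) '' (reflexLift Φ φ : Set (L ≃ₐ[ℚ] L))) (AlgHom.id ℚ L) :
        Set (L ≃ₐ[ℚ] L)) = typeLift Φ φ := by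
  ext g
  rw [mem_reflexLift, ← inv_mem_reflexLift_iff Φ φ g]
  have h1 : g⁻¹ • AlgHom.id ℚ L = ((g⁻¹ : L ≃ₐ[ℚ] L) : L →ₐ[ℚ] L) := AlgHom.ext fun _ => rfl
  rw [h1]
  constructor
  · rintro ⟨σ, hσ, hσg⟩
    have : σ = g⁻¹ := AlgEquiv.ext (fun x => AlgHom.congr_fun hσg x)
    exact this ▸ hσ
  · intro hg
    exact ⟨g⁻¹, hg, rfl⟩

/-- **… and its restrictions to `K` are exactly `Φ`** (`L/ℚ` normal): `{g ∘ φ ∣ g ∈ reflexLift (↑ '' S*) id} = Φ` — the reflex TYPE of the `L`-type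
`S*(Φ, φ)` read on `K` through `φ` is the corner type ([Streng2010 Ch. I Lemma 7.2] «`Φʳʳ = Φ`» for a primitive type; on embeddings of `K` no
primitivity is needed). [folklore] -/
theorem image_reflexLift_image_reflexLift_id_eq [Normal ℚ L] {K : Type*} [Field K] [Algebra ℚ K] (Φ : Set (K →ₐ[ℚ] L)) (φ : K →ₐ[ℚ] L) :
    (fun g : L ≃ₐ[ℚ] L => g • φ) ''
        (reflexLift ((fun σ : L ≃ₐ[ℚ] L => (σ : L →ₐ[ℚ] L)) '' (reflexLift Φ φ : Set (L ≃ₐ[ℚ] L))) (AlgHom.id ℚ L) :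
          Set (L ≃ₐ[ℚ] L)) = Φ := by
  rw [reflexLift_image_reflexLift_id_eq_typeLift]
  ext ψ
  constructor
  · rintro ⟨g, hg, rfl⟩
    exact hg
  · intro hψ
    obtain ⟨g, rfl⟩ := MulAction.exists_smul_eq (L ≃ₐ[ℚ] L) φ ψ
    exact ⟨g, hψ, rfl⟩

end ReflexField

/-- **PerL Lemma [lem:reflex] (b), field half, for the recipe's type**: for `L/ℚ` Galois and a primitive corner type read inside `L`, the reflex
field of the `L`-type `S*(Ψ_L, j)` (= `Φ_{Ψ}^{(false)}` on the orbit, `mem_liftType_false_iff_mem_reflexLift_alg`) is the corner field `j(K)`. [folklore] -/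
theorem reflexField_liftTypeSet_eq_fieldRange [IsGalois ℚ L] (Ψ : CMType K)
    (hP : IsPrimitive (L ≃ₐ[ℚ] L) (pullbackTypeAlg ι₁ Ψ) j.toRatAlgHom) :
    reflexField ℚ L ((fun σ : L ≃ₐ[ℚ] L => (σ : L →ₐ[ℚ] L)) ''
        (reflexLift (pullbackTypeAlg ι₁ Ψ) j.toRatAlgHom : Set (L ≃ₐ[ℚ] L))) = (j.toRatAlgHom : K →ₐ[ℚ] L).fieldRange :=
  reflexField_image_reflexLift_eq_fieldRange hP

/-- **PerL Lemma [lem:reflex] (b), type half, for the recipe's type** (`L/ℚ` normal): the reflex type of the `L`-type `S*(Ψ_L, j)`, read on `K`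
through `j`, is the corner type read inside `L`: `{g ∘ j ∣ g ∈ reflexLift (↑ '' S*(Ψ_L, j)) id} = Ψ_L`. [folklore] -/
theorem image_reflexLift_liftTypeSet_eq_pullbackTypeAlg [Normal ℚ L] (Ψ : CMType K) :
    (fun g : L ≃ₐ[ℚ] L => g • j.toRatAlgHom) ''
        (reflexLift ((fun σ : L ≃ₐ[ℚ] L => (σ : L →ₐ[ℚ] L)) ''
            (reflexLift (pullbackTypeAlg ι₁ Ψ) j.toRatAlgHom : Set (L ≃ₐ[ℚ] L))) (AlgHom.id ℚ L) : Set (L ≃ₐ[ℚ] L)) =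
      pullbackTypeAlg ι₁ Ψ :=
  image_reflexLift_image_reflexLift_id_eq _ _

end SignRecipe

end HodgeCM

end
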